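import Literature.MathematicalPhysics.QuantumFieldTheory.LatticeGauge
import Literature.MathematicalPhysics.QuantumFieldTheory.StringTensionAnalysis
import Literature.MathematicalPhysics.QuantumFieldTheory.TorusOddLoops
import HarnessLib

/-!
# Existence of the static potential and of the string tension: discharge of
`exists_hasStringTension`

This file proves the named fact `Literature.MathematicalPhysics.QuantumFieldTheory.exists_hasStringTension`
of `LatticeGauge` (inventory item constructive-qft.S12; Wilson 1974, Seiler LNP 159 §2,
Chatterjee arXiv:1803.01950 §4): for a compact gauge group with a continuous unitary matrix
representation `ρ`, `β ≥ 0`, `d ≥ 2` and an infinite-volume limit point `μ` of the torus Wilson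
states whose rectangular Wilson loop expectations do not vanish, the static potential
`V(R) = -lim_T T⁻¹ log W(R,T) ≥ 0` exists for every `R ≥ 1` and the string tension
`σ = lim_R V(R)/R ≥ 0` exists (`HasStringTension`).

## The proof

By `StringTension.hasStringTension_of_eventually` (`StringTensionAnalysis`) it suffices to
show, for the torus Wilson states on `(ℤ/(L+1)ℤ)^d` and all large `L`, the positivity
`0 ≤ ⟨W_{R×T}⟩` and the two log-convexities `⟨W_{R×(T+1)}⟩² ≤ ⟨W_{R×T}⟩⟨W_{R×(T+2)}⟩`,
`⟨W_{(R+1)×T}⟩² ≤ ⟨W_{R×T}⟩⟨W_{(R+2)×T}⟩`. In the time direction `0` these are the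
reflection-positivity inequalities of `TorusLoopLinkRP` / `TorusSiteRP` (even torus: reflections
in the hyperplanes between lattice planes for odd heights, in lattice hyperplanes for even
heights) and of `TorusOddLoops` (odd torus: the mixed reflection), after a parity split of the
torus size and of the height. The inequality in the direction `1` is reduced to the one in the
direction `0` by the symmetry of the torus Wilson state under the exchange of the coordinates
`0 ↔ 1` (`wilsonExpectation_wilsonLoop_swap`: the product Haar measure and the Wilson action
are invariant, a plaquette of the `(0,1)` plane being carried to its inverse, and
`W_{R×T} ∘ swap = W_{T×R}` by orientation reversal, `Re tr ρ(g⁻¹) = Re tr ρ(g)`).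
Everything here is proved; no definitions.

## References

* K. G. Wilson, Phys. Rev. D 10 (1974) 2445.
* E. Seiler, *Gauge Theories as a Problem of Constructive Quantum Field Theory and Statistical
  Mechanics*, LNP 159 (1982), §2 (static quark potential and string tension from reflection
  positivity); K. Osterwalder, E. Seiler, Ann. Phys. 110 (1978) 440, §2.
* S. Chatterjee, *Yang–Mills for probabilists*, arXiv:1803.01950, §4.
-/

noncomputable section

open MeasureTheory Filter Finset Complex
open scoped Topology

namespace Literature.MathematicalPhysics.QuantumFieldTheory

namespace StringTension

open Literature.RepresentationTheory.CompactGroups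

/-! ### The coordinate exchange `0 ↔ 1` -/

section Swap

variable {d L N : ℕ} [NeZero d] {G : Type*} [Group G]

/-- Permuting coordinates commutes with displacements:
`(x + c eᵢ) ∘ σ = x ∘ σ + c e_{σ i}` for the transposition `σ = (0 1)`. [folklore] -/
theorem comp_swap_add_single (x : Site d L) (i : Fin d) (c : ZMod L) :
    (fun k => (x + Pi.single i c : Site d L) (Equiv.swap (0 : Fin d) 1 k)) =
      (fun k => x (Equiv.swap (0 : Fin d) 1 k)) + Pi.single (Equiv.swap (0 : Fin d) 1 i) c := by
  funext k
  simp only [Pi.add_apply]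
  congr 1
  by_cases hk : Equiv.swap (0 : Fin d) 1 k = i
  · have hk' : k = Equiv.swap (0 : Fin d) 1 i := by rw [← hk, Equiv.swap_apply_self]
    rw [hk, hk', Pi.single_eq_same, Pi.single_eq_same]
  · have hk' : k ≠ Equiv.swap (0 : Fin d) 1 i := fun h => hk (by rw [h, Equiv.swap_apply_self])
    rw [Pi.single_eq_of_ne hk, Pi.single_eq_of_ne hk']

/-- Line holonomies of the coordinate-exchanged configuration. [folklore] -/
theorem lineHolonomy_swap (U : GaugeConfig d L G) (k : Fin d) :
    ∀ (n : ℕ) (y : Site d L),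
      lineHolonomy (fun e : Edge d L => U ((fun k' => e.1 (Equiv.swap (0 : Fin d) 1 k')),
        Equiv.swap (0 : Fin d) 1 e.2)) k n y =
      lineHolonomy U (Equiv.swap (0 : Fin d) 1 k) n (fun k' => y (Equiv.swap (0 : Fin d) 1 k'))
  | 0, _ => rfl
  | n + 1, y => by
      rw [lineHolonomy_succ, lineHolonomy_succ, lineHolonomy_swap U k n]
      simp only [Site.shift, comp_swap_add_single]

/-- Rectangle holonomies of the coordinate-exchanged configuration. [folklore] -/
theorem rectangleHolonomy_swap (U : GaugeConfig d L G) (x : Site d L) (i j : Fin d) (R T : ℕ) :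
    rectangleHolonomy (fun e : Edge d L => U ((fun k' => e.1 (Equiv.swap (0 : Fin d) 1 k')),
        Equiv.swap (0 : Fin d) 1 e.2)) x i j R T =
      rectangleHolonomy U (fun k' => x (Equiv.swap (0 : Fin d) 1 k')) (Equiv.swap (0 : Fin d) 1 i)
        (Equiv.swap (0 : Fin d) 1 j) R T := by
  simp only [rectangleHolonomy, lineHolonomy_swap, comp_swap_add_single]

omit [NeZero d] in
/-- **Orientation reversal**: the rectangle traversed first in direction `j` is the inverse of
the rectangle traversed first in direction `i`. [folklore] -/
theorem rectangleHolonomy_symm (U : GaugeConfig d L G) (x : Site d L) (i j : Fin d) (R T : ℕ) :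
    rectangleHolonomy U x j i T R = (rectangleHolonomy U x i j R T)⁻¹ := by
  unfold rectangleHolonomy
  group

/-- **`W_{R×T} ∘ swap = W_{T×R}`** for the loops at the origin of the `(0,1)` plane and a
continuous representation (`Re tr ρ(g⁻¹) = Re tr ρ(g)`). [folklore] -/
theorem wilsonLoop_swap [TopologicalSpace G] [IsTopologicalGroup G] [CompactSpace G]
    (ρ : G →* Matrix (Fin N) (Fin N) ℂ) (hρ : Continuous ρ) (R T : ℕ) (U : GaugeConfig d L G) :
    wilsonLoop ρ (0 : Site d L) 0 1 R T (fun e : Edge d L =>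
        U ((fun k' => e.1 (Equiv.swap (0 : Fin d) 1 k')), Equiv.swap (0 : Fin d) 1 e.2)) =
      wilsonLoop ρ (0 : Site d L) 0 1 T R U := by
  unfold wilsonLoop
  rw [rectangleHolonomy_swap, Equiv.swap_apply_left, Equiv.swap_apply_right,
    show (fun k' => (0 : Site d L) (Equiv.swap (0 : Fin d) 1 k')) = (0 : Site d L) from rfl,
    rectangleHolonomy_symm, CompactGroup.re_trace_map_inv ρ hρ]

/-- Plaquette holonomies of the coordinate-exchanged configuration. [folklore] -/
theorem plaquetteHolonomy_swap (U : GaugeConfig d L G) (x : Site d L) (i j : Fin d) :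
    plaquetteHolonomy (fun e : Edge d L => U ((fun k' => e.1 (Equiv.swap (0 : Fin d) 1 k')),
        Equiv.swap (0 : Fin d) 1 e.2)) x i j =
      plaquetteHolonomy U (fun k' => x (Equiv.swap (0 : Fin d) 1 k')) (Equiv.swap (0 : Fin d) 1 i)
        (Equiv.swap (0 : Fin d) 1 j) := by
  simp only [plaquetteHolonomy, Site.shift, comp_swap_add_single]

omit [NeZero d] in
/-- The plaquette traversed in the opposite orientation has the inverse holonomy. [folklore] -/
theorem plaquetteHolonomy_symm (U : GaugeConfig d L G) (x : Site d L) (i j : Fin d) :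
    plaquetteHolonomy U x j i = (plaquetteHolonomy U x i j)⁻¹ := by
  unfold plaquetteHolonomy
  group

/-- The exchange of the two directions of a plaquette index (`σ i`, `σ j` reordered). [folklore] -/
theorem swap_lt_or_lt {i j : Fin d} (h : i < j) :
    Equiv.swap (0 : Fin d) 1 i < Equiv.swap (0 : Fin d) 1 j ∨
      Equiv.swap (0 : Fin d) 1 j < Equiv.swap (0 : Fin d) 1 i := by
  rcases lt_trichotomy (Equiv.swap (0 : Fin d) 1 i) (Equiv.swap (0 : Fin d) 1 j) with h' | h' | h'
  · exact Or.inl h'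
  · exact absurd ((Equiv.swap (0 : Fin d) 1).injective h') (ne_of_lt h)
  · exact Or.inr h'

/-- **The Wilson action is invariant under the coordinate exchange** (a plaquette goes to a
plaquette, possibly traversed backwards; `Re tr ρ(g⁻¹) = Re tr ρ(g)`). [folklore] -/
theorem wilsonAction_swap [NeZero L] [TopologicalSpace G] [IsTopologicalGroup G] [CompactSpace G]
    (ρ : G →* Matrix (Fin N) (Fin N) ℂ) (hρ : Continuous ρ) (U : GaugeConfig d L G) :
    wilsonAction ρ (fun e : Edge d L =>
        U ((fun k' => e.1 (Equiv.swap (0 : Fin d) 1 k')), Equiv.swap (0 : Fin d) 1 e.2)) =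
      wilsonAction ρ U := by
  -- the map on plaquettes
  have hne : ∀ q : {p : Fin d × Fin d // p.1 < p.2},
      ¬ Equiv.swap (0 : Fin d) 1 q.1.1 < Equiv.swap (0 : Fin d) 1 q.1.2 →
        Equiv.swap (0 : Fin d) 1 q.1.2 < Equiv.swap (0 : Fin d) 1 q.1.1 :=
    fun q h => (swap_lt_or_lt q.2).resolve_left h
  set f : Plaquette d L → Plaquette d L := fun p =>
    ((fun k' => p.1 (Equiv.swap (0 : Fin d) 1 k')),
      if h : Equiv.swap (0 : Fin d) 1 p.2.1.1 < Equiv.swap (0 : Fin d) 1 p.2.1.2 then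
        ⟨(Equiv.swap (0 : Fin d) 1 p.2.1.1, Equiv.swap (0 : Fin d) 1 p.2.1.2), h⟩
      else ⟨(Equiv.swap (0 : Fin d) 1 p.2.1.2, Equiv.swap (0 : Fin d) 1 p.2.1.1), hne p.2 h⟩) with hf
  have hinv : Function.Involutive f := by
    intro p
    obtain ⟨x, ⟨⟨i, j⟩, hij⟩⟩ := p
    simp only [hf]
    refine Prod.ext ?_ ?_
    · funext k
      simp only [Equiv.swap_apply_self]
    · by_cases h : Equiv.swap (0 : Fin d) 1 i < Equiv.swap (0 : Fin d) 1 j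
      · simp only [h, ↓reduceDIte, Equiv.swap_apply_self, hij]
      · simp only [h, ↓reduceDIte, Equiv.swap_apply_self, dif_neg (lt_asymm hij)]
  unfold wilsonAction
  refine Finset.sum_equiv (Function.Involutive.toPerm f hinv) (fun p => by simp) fun p _ => ?_
  obtain ⟨x, ⟨⟨i, j⟩, hij⟩⟩ := p
  simp only [Function.Involutive.coe_toPerm, hf]
  rw [plaquetteHolonomy_swap]
  by_cases h : Equiv.swap (0 : Fin d) 1 i < Equiv.swap (0 : Fin d) 1 j
  · simp only [h, ↓reduceDIte]
  · simp only [h, ↓reduceDIte]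
    rw [plaquetteHolonomy_symm U _ (Equiv.swap (0 : Fin d) 1 j) (Equiv.swap (0 : Fin d) 1 i),
      CompactGroup.re_trace_map_inv ρ hρ]

variable [TopologicalSpace G] [IsTopologicalGroup G] [CompactSpace G] [MeasurableSpace G]
  [BorelSpace G] (ρ : G →* Matrix (Fin N) (Fin N) ℂ)

/-- **The torus Wilson expectation is invariant under the coordinate exchange `0 ↔ 1`** (the
product Haar measure is invariant under the induced permutation of links, the Wilson action by
`wilsonAction_swap`). [folklore] -/
theorem wilsonExpectation_comp_swap [NeZero L] (hρ : Continuous ρ) (β : ℝ) (F : GaugeConfig d L G → ℝ) :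
    wilsonExpectation ρ β (fun U => F (fun e : Edge d L =>
        U ((fun k' => e.1 (Equiv.swap (0 : Fin d) 1 k')), Equiv.swap (0 : Fin d) 1 e.2))) =
      wilsonExpectation ρ β F := by
  -- the permutation of the links and the induced measurable equivalence of configurations
  set g : Edge d L → Edge d L := fun e =>
    ((fun k' => e.1 (Equiv.swap (0 : Fin d) 1 k')), Equiv.swap (0 : Fin d) 1 e.2) with hg
  have hginv : Function.Involutive g := by
    intro e
    obtain ⟨x, i⟩ := e
    simp only [hg, Equiv.swap_apply_self]
  set eσ : GaugeConfig d L G ≃ᵐ GaugeConfig d L G :=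
    MeasurableEquiv.arrowCongr' (Function.Involutive.toPerm g hginv) (MeasurableEquiv.refl G) with heσ
  have heσ_apply : ∀ U : GaugeConfig d L G, eσ U = fun e => U (g e) := by
    intro U
    funext e
    show U ((Function.Involutive.toPerm g hginv).symm e) = U (g e)
    rw [Function.Involutive.toPerm_symm, Function.Involutive.coe_toPerm]
  have hπ : (Measure.pi fun _ : Edge d L => haarProbability G).map eσ =
      Measure.pi fun _ : Edge d L => haarProbability G :=
    (measurePreserving_arrowCongr' (fun _ : Edge d L => haarProbability G)
      (fun _ : Edge d L => haarProbability G) (Function.Involutive.toPerm g hginv)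
      (MeasurableEquiv.refl G) fun _ => MeasurePreserving.id _).map_eq
  have hμ : (wilsonMeasure ρ β).map eσ = wilsonMeasure (d := d) (L := L) (G := G) ρ β := by
    simp only [wilsonMeasure, Measure.map_smul, wilsonWeight]
    rw [withDensity_map_of_measurableEquiv _ _ _ hπ]
    intro U
    rw [heσ_apply, hg, wilsonAction_swap ρ hρ]
  have hcomp : (fun U => F (fun e : Edge d L =>
      U ((fun k' => e.1 (Equiv.swap (0 : Fin d) 1 k')), Equiv.swap (0 : Fin d) 1 e.2))) = F ∘ eσ := by
    funext U
    rw [Function.comp_apply, heσ_apply]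
  rw [hcomp]
  simp only [wilsonExpectation, Function.comp_apply]
  rw [← integral_map_equiv, hμ]

/-- **Symmetry of the torus loop expectations**: `⟨W_{R×T}⟩ = ⟨W_{T×R}⟩` for the rectangles at
the origin of the `(0,1)` plane. [folklore] -/
theorem wilsonExpectation_wilsonLoop_swap [NeZero L] (hρ : Continuous ρ) (β : ℝ) (R T : ℕ) :
    wilsonExpectation ρ β (wilsonLoop ρ (0 : Site d L) 0 1 R T) =
      wilsonExpectation ρ β (wilsonLoop ρ (0 : Site d L) 0 1 T R) := by
  rw [← wilsonExpectation_comp_swap ρ hρ β (wilsonLoop ρ (0 : Site d L) 0 1 R T)]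
  congr 1
  funext U
  exact wilsonLoop_swap ρ hρ R T U

end Swap

/-! ### The torus inequalities, all parities -/

section Torus

variable {d L N : ℕ} [NeZero d] [NeZero L] [Fact (1 < L)] {G : Type*} [Group G] [TopologicalSpace G]
  [IsTopologicalGroup G] [CompactSpace G] [MeasurableSpace G] [BorelSpace G]
  (ρ : G →* Matrix (Fin N) (Fin N) ℂ)

/-- **Positivity of rectangular Wilson loop expectations** on every torus large compared to the
loop (`β ≥ 0`, continuous `ρ`, `j ≠ 0`, `n ≥ 1`, `n + 3 ≤ L`): `0 ≤ ⟨W_{n×m}⟩` (parity split of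
`L` and of `n` over the four reflection-positivity positivity statements). [folklore] -/
theorem wilsonExpectation_wilsonLoop_nonneg (hρ : Continuous ρ) {β : ℝ} (hβ : 0 ≤ β) {j : Fin d}
    (hj : j ≠ 0) {n : ℕ} (hn1 : 1 ≤ n) (hn : 2 * n + 4 ≤ L) (m : ℕ) :
    0 ≤ wilsonExpectation ρ β (wilsonLoop ρ (0 : Site d L) 0 j n m) := by
  have h1L : 1 < L := Fact.out
  rcases Nat.even_or_odd L with hL | hL
  · have hE := Nat.even_iff.mp hL
    rcases Nat.even_or_odd n with ⟨k, hk⟩ | ⟨k, hk⟩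
    · rw [hk]
      exact wilsonExpectation_wilsonLoop_nonneg_of_even ρ hL hρ β hj (b := k) (by omega) (by omega) m
    · rw [hk, show 2 * k + 1 = k + (k + 1) by ring]
      exact wilsonExpectation_wilsonLoop_nonneg_of_odd ρ hL hρ hβ hj (p := k) (by omega) m
  · have hO := Nat.odd_iff.mp hL
    rcases Nat.even_or_odd n with ⟨k, hk⟩ | ⟨k, hk⟩
    · rw [hk]
      exact (wilsonExpectation_wilsonLoop_site_oddTorus ρ hL hρ hβ hj (b := k) (a := k - 1) (by omega)
        (by omega) (by omega) m).1
    · rw [hk, show 2 * k + 1 = k + (k + 1) by ring]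
      exact (wilsonExpectation_wilsonLoop_link_oddTorus ρ hL hρ hβ hj (p := k) (q := k) (by omega)
        (by omega) m).1

/-- **Log-convexity of rectangular Wilson loop expectations in the time direction** on every
torus large compared to the loop: `⟨W_{(n+1)×m}⟩² ≤ ⟨W_{n×m}⟩ ⟨W_{(n+2)×m}⟩` for `n ≥ 1`
(parity split of `L` and of `n + 1` over the four reflection-positivity Schwarz inequalities).
[folklore] -/
theorem wilsonExpectation_wilsonLoop_sq_le (hρ : Continuous ρ) {β : ℝ} (hβ : 0 ≤ β) {j : Fin d}
    (hj : j ≠ 0) {n : ℕ} (hn1 : 1 ≤ n) (hn : 2 * n + 6 ≤ L) (m : ℕ) :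
    wilsonExpectation ρ β (wilsonLoop ρ (0 : Site d L) 0 j (n + 1) m) ^ 2 ≤
      wilsonExpectation ρ β (wilsonLoop ρ (0 : Site d L) 0 j n m) *
        wilsonExpectation ρ β (wilsonLoop ρ (0 : Site d L) 0 j (n + 2) m) := by
  have h1L : 1 < L := Fact.out
  rcases Nat.even_or_odd L with hL | hL
  · have hE := Nat.even_iff.mp hL
    rcases Nat.even_or_odd (n + 1) with ⟨k, hk⟩ | ⟨k, hk⟩
    · -- `n + 1 = 2k` even: link planes with `p = k`, `q = k - 1`
      have h := wilsonExpectation_wilsonLoop_sq_le_of_link ρ hL hρ hβ hj (p := k) (q := k - 1)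
        (by omega) (by omega) m
      rw [show k - 1 + (k + 1) = n + 1 by omega, show k + (k + 1) = n + 2 by omega,
        show k - 1 + (k - 1 + 1) = n by omega, mul_comm] at h
      exact h
    · -- `n + 1 = 2k + 1` odd: lattice planes with `b = k`, `a = k`
      have h := wilsonExpectation_wilsonLoop_sq_le_of_site ρ hL hρ β hj (b := k) (a := k)
        (by omega) (by omega) (by omega) m
      rw [show k + (k + 1) = n + 1 by omega, show k + k = n by omega,
        show k + 1 + (k + 1) = n + 2 by omega] at h
      exact h
  · have hO := Nat.odd_iff.mp hL
    rcases Nat.even_or_odd (n + 1) with ⟨k, hk⟩ | ⟨k, hk⟩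
    · have h := (wilsonExpectation_wilsonLoop_link_oddTorus ρ hL hρ hβ hj (p := k) (q := k - 1)
        (by omega) (by omega) m).2
      rw [show k - 1 + (k + 1) = n + 1 by omega, show k + (k + 1) = n + 2 by omega,
        show k - 1 + (k - 1 + 1) = n by omega, mul_comm] at h
      exact h
    · have h := (wilsonExpectation_wilsonLoop_site_oddTorus ρ hL hρ hβ hj (b := k) (a := k)
        (by omega) (by omega) (by omega) m).2
      rw [show k + (k + 1) = n + 1 by omega, show k + k = n by omega,
        show k + 1 + (k + 1) = n + 2 by omega] at h
      exact h

end Torus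

end StringTension

/-! ### The discharge -/

section Discharge

variable {d N : ℕ} {G : Type*} [Group G] [TopologicalSpace G] [IsTopologicalGroup G] [CompactSpace G]
  [MeasurableSpace G] [BorelSpace G] [NeZero d] (ρ : G →* Matrix (Fin N) (Fin N) ℂ)

/-- **constructive-qft.S12, string tension of an infinite-volume lattice gauge state — proved**
(discharge of the named fact `exists_hasStringTension`; Wilson, Phys. Rev. D 10 (1974) 2445;
Seiler LNP 159 §2; Chatterjee arXiv:1803.01950 §4). For a compact gauge group `G` with a
continuous (unitary) matrix representation `ρ`, `β ≥ 0`, `d ≥ 2`, and an infinite-volume limit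
point `μ` of the torus Wilson states whose rectangular Wilson loop expectations `W(R,T)`,
`R, T ≥ 1`, do not vanish, there is `σ ≥ 0` with `HasStringTension μ χ σ`, `χ = (1/N) Re tr ρ`:
the static potentials `V(R) = lim_T -log|W(R,T)|/T` exist for all `R ≥ 1` and `V(R)/R → σ`.
Proof: reflection positivity of the torus Wilson measure in the hyperplanes between lattice
planes and in the lattice hyperplanes (for odd tori: the mixed reflection) gives, by the Schwarz
inequality applied to staples, `0 ≤ W_L(n,m)` and `W_L(n+1,m)² ≤ W_L(n,m) W_L(n+2,m)` on all
large tori (`StringTension.wilsonExpectation_wilsonLoop_nonneg`, `…_sq_le`), in both directions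
by the coordinate-exchange symmetry; these pass to the limit point, and with `|W| ≤ 1` the
non-negative concave sequences `-log W(R,·)`, then `V`, have linear rates
(`StringTension.hasStringTension_of_eventually`). The unitarity hypothesis of the fact is not
needed (Weyl's unitarian trick is used instead).
[cite: SeilerLNP1982, §2 (static quark potential and string tension from reflection positivity)] -/
theorem exists_hasStringTension_holds : exists_hasStringTension (d := d) ρ := by
  intro hd hρ _hρu β hβ μ hμ hW
  have h10 : (1 : Fin d) ≠ 0 := by
    intro h01
    have := congrArg Fin.val h01
    rw [Fin.val_zero, Fin.val_one', Nat.one_mod_eq_one.mpr (by omega)] at this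
    exact one_ne_zero this
  refine StringTension.hasStringTension_of_eventually ρ hρ hμ (fun R T hR _ => ?_)
    (fun R T hR hT => ?_) (fun R T hR _ => ?_) hW
  · filter_upwards [eventually_ge_atTop (2 * R + 4)] with L hL
    haveI : Fact (1 < L + 1) := ⟨by omega⟩
    exact StringTension.wilsonExpectation_wilsonLoop_nonneg ρ hρ hβ h10 hR (by omega) T
  · filter_upwards [eventually_ge_atTop (2 * T + 6)] with L hL
    haveI : Fact (1 < L + 1) := ⟨by omega⟩
    rw [StringTension.wilsonExpectation_wilsonLoop_swap ρ hρ β R (T + 1),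
      StringTension.wilsonExpectation_wilsonLoop_swap ρ hρ β R T,
      StringTension.wilsonExpectation_wilsonLoop_swap ρ hρ β R (T + 2)]
    exact StringTension.wilsonExpectation_wilsonLoop_sq_le ρ hρ hβ h10 hT (by omega) R
  · filter_upwards [eventually_ge_atTop (2 * R + 6)] with L hL
    haveI : Fact (1 < L + 1) := ⟨by omega⟩
    exact StringTension.wilsonExpectation_wilsonLoop_sq_le ρ hρ hβ h10 hR (by omega) T

end Discharge

end Literature.MathematicalPhysics.QuantumFieldTheory
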